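import Literature.NumberTheory.GaloisRepresentations.ContinuousH1
import Literature.GroupTheory.PadicIntCompactImageProofs
import Mathlib.GroupTheory.Coset.Card
import Mathlib.SetTheory.Cardinal.Finite
import HarnessLib

/-!
# Counting the classes of `H¹(G, X)` that die on a topologically co-generating subgroup (proofs file)

`Proofs` file (THEOREMS ONLY; no definition, no named fact, no instance, no notation, no `sorry`) in topic
`NumberTheory/GaloisRepresentations`; currency of `ContinuousH1.lean` (continuous crossed homomorphisms
`contOneCocycles X`, their classes `oneCocycleClass X`, pullbacks `contOneCocycles.pullback`, functoriality
`map_oneCocycleClass`).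

Let `G` be a topological group, `X : TopRep R G` a topological `G`-module with continuous orbit maps whose underlying
space is FINITE and DISCRETE, `S ≤ G` a subgroup and `g₀ ∈ G` an element normalising `S` such that the subgroup
generated by `S` and `g₀` is DENSE in `G` (e.g. `S` closed normal with `G ⧸ S` procyclic and `g₀` a lift of a
topological generator — the situation `G = Gal(K̄_v/K_v) ⊇ S = Gal(K̄_v/K_{∞,w})` for a `ℤ_p`-extension `K_∞/K` at a
finite place `v`). Then:

* §1 a continuous crossed homomorphism vanishing on `S` and at `g₀` is zero
  (`contOneCocycles.eq_zero_of_forall_mem_eq_zero_of_apply_eq_zero`: its zero locus is a closed subgroup containing a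
  dense one); dually, a vector fixed by `S` and `g₀` is fixed by `G`
  (`forall_apply_eq_self_of_forall_mem_of_apply_eq_self`).
* §2 a crossed homomorphism vanishing on `S` takes `S`-invariant values at `g₀`
  (`contOneCocycles.apply_eq_self_of_forall_mem_eq_zero`); `(g₀ − 1)X^S ⊆ X^S`.
* §3 **`natCard_setOf_oneCocycleClass_restrict_eq_zero_le`**: the classes `x ∈ H¹(G, X)` represented by a crossed
  homomorphism that is PRINCIPAL ON `S` (`φ s = s•v − v` for `s ∈ S`) form a finite set of size at most
  `#H⁰(G, X) = #{v | ∀ g, g•v = v}`.  Proof: such a class has a representative vanishing on `S`; `ψ ↦ ψ(g₀)` embeds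
  these (§1) into `X^S` and matches the principal ones with `(g₀ − 1)X^S`, so the classes embed into
  `X^S ⧸ (g₀ − 1)X^S`, whose order is `#ker(g₀ − 1 | X^S) = #X^{⟨S, g₀⟩} = #X^G` (§1).
* §4 `natCard_setOf_map_oneCocycleClass_eq_zero_le` — the same bound for the kernel of the restriction
  `ContinuousCohomology.map θ f 1` along any continuous `θ : H → G` mapping onto `S` (`f` bijective, e.g. the
  identity of the restricted module).
* §5 `exists_dense_closure_ker_union_singleton` — THE HYPOTHESIS HOLDS for `S = ker κ`, `κ : D →ₜ* ℤ_p` any continuous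
  homomorphism on a COMPACT group `D` (the image is `0` or `p^e ℤ_p`, `PadicIntCompactImageProofs`; take `g₀` with
  `κ(g₀) = p^e`; a closed subgroup containing `ker κ` and `g₀` has closed image `⊇ p^e ℤ_p`, hence is everything) —
  e.g. `D = Γ_{K_v}`, `κ` = a `ℤ_p`-extension of `K` restricted to the decomposition group at `v`.
* §6 `natCard_fixedBy_smul_le_natCard_quotient_span` — the matching `H⁰` bound for a CYCLIC LINE: for `X = S·x₀` finite
  and `μ ∈ S`, `#{x | μ•x = x} ≤ #(S ⧸ (μ − 1))` (`#ker = #coker` on a finite group, and `S ⧸ (μ−1) ↠ X ⧸ (μ−1)X`); with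
  `natCard_setOf_forall_apply_eq_self_le_of_apply_eq_smul`: if ONE `g₁ ∈ G` acts on `X` as the scalar `μ` then
  `#H⁰(G, X) ≤ #(S ⧸ (μ − 1))` — for Howard's graded line `gr_v T^{(j)} = A_{m,j} ⊗ gr_v E[p^j]` and `g₁` with
  `κ(g₁) = p^s`, `μ − 1 = λ(1+T)^{p^s} − 1` has a unit coefficient in degree `p^s < m`, so the bound is `p^{p^s}`
  (`natCard_quotient_span_mk_le_of_isUnit_coeff`), uniformly in `j` and `m`.

This is the counting half of inflation–restriction for a procyclic quotient (`H¹(⟨g₀⟩^, B) = B/(g₀−1)B` for finite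
`B`, `#(B/(g₀−1)B) = #B^{g₀}`), stated without forming the quotient group. Consumer (cell `pub/bsd-print-x9`, shared
μ-crux stmt-BirchSwinnertonDyer-23237, STUB B clause (B5) `Stmt.readoutIndex`): the `m`-UNIFORM bound on the local
defect at `w ∣ p` between «Kummer/strict condition over `K_{∞,w}`» and «ordinary core over `K_v`» for Howard's tower
`T^{(j)} = E[p^{j+1}] ⊗ A_{m,j+1}(ψ⁻¹)`, through `#H⁰(K_v, gr_v T^{(j)}) ≤ p^{p^s}`.

References: [SerreGaloisCohomology1997] J.-P. Serre, *Galois Cohomology* (1997), Ch. I §2.2, §2.4, §2.6(b)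
(inflation–restriction), and *Local Fields* Ch. XIII §1 Prop. 1 (`H¹` of a procyclic group is `A/(F − 1)A`);
[NeukirchSchmidtWingberg2008] (1.6.7), (1.7.7); [Howard2004HeegnerKolyvagin] B. Howard, Compositio Math. 140 (2004),
Prop. 2.2.8 and proof of Thm. 2.2.10 (the `𝔮 = T^m + p` control, local terms); [GreenbergLNM1716] R. Greenberg,
LNM 1716 (1999), §3 (local kernels `ker(H¹(K_v, ·) → H¹(K_{∞,w}, ·))`).  BSD is not proved by any of this.
-/

noncomputable section

open TopRep ContRepresentation ContinuousCohomology Topology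

namespace Literature.NumberTheory.GaloisRepresentations

universe u v

variable {R : Type u} [Ring R] [TopologicalSpace R]
variable {G : Type v} [Group G] [TopologicalSpace G] [IsTopologicalGroup G]
variable {X : TopRep.{v} R G}

/-! ## §1 Zero loci of crossed homomorphisms and stabilisers: closed subgroups, hence everything when dense -/

omit [TopologicalSpace G] [IsTopologicalGroup G] in
/-- The action of `g` on `X` is injective (it is inverted by `g⁻¹`). [cite: SerreGaloisCohomology1997, Ch. I §2.2] -/
theorem contOneCocycles.rho_apply_eq_zero_iff (g : G) (x : X) : X.ρ g x = 0 ↔ x = 0 := by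
  constructor
  · intro h
    have h1 : X.ρ g⁻¹ (X.ρ g x) = x := by
      change (X.ρ g⁻¹ * X.ρ g) x = x
      rw [← map_mul, inv_mul_cancel, _root_.map_one]
      rfl
    rw [← h1, h, map_zero]
  · rintro rfl
    exact map_zero _

omit [IsTopologicalGroup G] in
/-- A crossed homomorphism vanishes on the subgroup GENERATED by any set on which it vanishes (`φ 1 = 0`,
`φ (g h) = φ g + g • φ h`, `g • φ (g⁻¹) = −φ g`). [cite: SerreGaloisCohomology1997, Ch. I §5.1 (crossed homomorphisms)] -/
theorem contOneCocycles.forall_mem_closure_eq_zero (φ : contOneCocycles X) {k : Set G}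
    (hk : ∀ g ∈ k, φ.1 g = 0) : ∀ g ∈ Subgroup.closure k, φ.1 g = 0 := by
  intro g hg
  induction hg using Subgroup.closure_induction with
  | mem x hx => exact hk x hx
  | one => exact contOneCocycles.apply_one φ
  | mul a b _ _ ha hb => rw [φ.2 a b, ha, hb, map_zero, add_zero]
  | inv a _ ha =>
    have h := contOneCocycles.apply_smul_inv_mul φ a 1
    rw [mul_one, contOneCocycles.apply_one, ha, sub_zero] at h
    exact (contOneCocycles.rho_apply_eq_zero_iff a _).1 h

omit [IsTopologicalGroup G] in
/-- **A continuous crossed homomorphism (values in a `T₁` module) vanishing on a subgroup `S` and at an element `g₀`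
with `⟨S, g₀⟩` dense vanishes identically**: its zero locus is closed and contains a dense subgroup.
[cite: SerreGaloisCohomology1997, Ch. I §2.2] [cite: NeukirchSchmidtWingberg2008, (1.7.7) (procyclic groups)] -/
theorem contOneCocycles.eq_zero_of_forall_mem_eq_zero_of_apply_eq_zero [T1Space X] (S : Subgroup G) (g₀ : G)
    (hdense : Dense ((Subgroup.closure ((S : Set G) ∪ {g₀})) : Set G)) (φ : contOneCocycles X)
    (hS : ∀ s ∈ S, φ.1 s = 0) (hg₀ : φ.1 g₀ = 0) : φ = 0 := by
  have hk : ∀ g ∈ ((S : Set G) ∪ {g₀}), φ.1 g = 0 := by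
    rintro g (hg | hg)
    · exact hS g hg
    · rw [Set.mem_singleton_iff.1 hg]; exact hg₀
  have hsub : ((Subgroup.closure ((S : Set G) ∪ {g₀})) : Set G) ⊆ φ.1 ⁻¹' {0} :=
    fun g hg ↦ contOneCocycles.forall_mem_closure_eq_zero φ hk g hg
  have hclosed : IsClosed (φ.1 ⁻¹' ({0} : Set X)) := isClosed_singleton.preimage φ.1.continuous
  have hall : φ.1 ⁻¹' ({0} : Set X) = Set.univ := by
    rw [← hclosed.closure_eq]
    exact (hdense.mono hsub).closure_eq
  refine Subtype.ext (ContinuousMap.ext fun g ↦ ?_)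
  have hg : g ∈ φ.1 ⁻¹' ({0} : Set X) := by rw [hall]; exact Set.mem_univ g
  exact hg

omit [TopologicalSpace G] [IsTopologicalGroup G] in
/-- A vector fixed by every element of a set is fixed by the subgroup it generates.
[cite: SerreGaloisCohomology1997, Ch. I §2.2] -/
theorem forall_mem_closure_apply_eq_self (v : X) {k : Set G} (hk : ∀ g ∈ k, X.ρ g v = v) :
    ∀ g ∈ Subgroup.closure k, X.ρ g v = v := by
  intro g hg
  induction hg using Subgroup.closure_induction with
  | mem x hx => exact hk x hx
  | one => rw [_root_.map_one]; rfl
  | mul a b _ _ ha hb =>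
    rw [map_mul]
    change X.ρ a (X.ρ b v) = v
    rw [hb, ha]
  | inv a _ ha =>
    conv_lhs => rw [← ha]
    change (X.ρ a⁻¹ * X.ρ a) v = v
    rw [← map_mul, inv_mul_cancel, _root_.map_one]
    rfl

omit [IsTopologicalGroup G] in
/-- **A vector with continuous orbit map (in a `T₁` module) fixed by `S` and by `g₀`, with `⟨S, g₀⟩` dense, is fixed
by all of `G`.** [cite: SerreGaloisCohomology1997, Ch. I §2.2] [cite: NeukirchSchmidtWingberg2008, (1.7.7)] -/
theorem forall_apply_eq_self_of_forall_mem_of_apply_eq_self [T1Space X] (S : Subgroup G) (g₀ : G)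
    (hdense : Dense ((Subgroup.closure ((S : Set G) ∪ {g₀})) : Set G)) (v : X)
    (hX : Continuous fun g : G ↦ X.ρ g v) (hS : ∀ s ∈ S, X.ρ s v = v) (hg₀ : X.ρ g₀ v = v) (g : G) :
    X.ρ g v = v := by
  have hk : ∀ g ∈ ((S : Set G) ∪ {g₀}), X.ρ g v = v := by
    rintro g (hg | hg)
    · exact hS g hg
    · rw [Set.mem_singleton_iff.1 hg]; exact hg₀
  have hsub : ((Subgroup.closure ((S : Set G) ∪ {g₀})) : Set G) ⊆ (fun g : G ↦ X.ρ g v) ⁻¹' {v} :=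
    fun g hg ↦ forall_mem_closure_apply_eq_self v hk g hg
  have hclosed : IsClosed ((fun g : G ↦ X.ρ g v) ⁻¹' ({v} : Set X)) := isClosed_singleton.preimage hX
  have hall : (fun g : G ↦ X.ρ g v) ⁻¹' ({v} : Set X) = Set.univ := by
    rw [← hclosed.closure_eq]
    exact (hdense.mono hsub).closure_eq
  have hg : g ∈ (fun g : G ↦ X.ρ g v) ⁻¹' ({v} : Set X) := by rw [hall]; exact Set.mem_univ g
  exact hg

/-! ## §2 Crossed homomorphisms vanishing on a normalised subgroup -/

omit [IsTopologicalGroup G] in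
/-- A crossed homomorphism vanishing on `S` is right `S`-invariant: `φ (g s) = φ g`.
[cite: SerreGaloisCohomology1997, Ch. I §2.6(b) (proof of inflation–restriction)] -/
theorem contOneCocycles.apply_mul_of_mem_eq (φ : contOneCocycles X) (S : Subgroup G)
    (hS : ∀ s ∈ S, φ.1 s = 0) (g : G) {s : G} (hs : s ∈ S) : φ.1 (g * s) = φ.1 g := by
  rw [φ.2 g s, hS s hs, map_zero, add_zero]

omit [IsTopologicalGroup G] in
/-- **A crossed homomorphism vanishing on `S` takes an `S`-invariant value at any `g₀` normalising `S`**
(`s • φ g₀ = φ (s g₀) = φ (g₀ · g₀⁻¹ s g₀) = φ g₀`). [cite: SerreGaloisCohomology1997, Ch. I §2.6(b)] -/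
theorem contOneCocycles.apply_eq_self_of_forall_mem_eq_zero (φ : contOneCocycles X) (S : Subgroup G) (g₀ : G)
    (hnorm : ∀ s ∈ S, g₀⁻¹ * s * g₀ ∈ S) (hS : ∀ s ∈ S, φ.1 s = 0) {s : G} (hs : s ∈ S) :
    X.ρ s (φ.1 g₀) = φ.1 g₀ := by
  have h1 : s * g₀ = g₀ * (g₀⁻¹ * s * g₀) := by simp [mul_assoc]
  have h2 := φ.2 s g₀
  rw [hS s hs, zero_add, h1, contOneCocycles.apply_mul_of_mem_eq φ S hS g₀ (hnorm s hs)] at h2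
  exact h2.symm

omit [TopologicalSpace G] [IsTopologicalGroup G] in
/-- For `v ∈ X^S` and `g₀` normalising `S`, `g₀ • v − v ∈ X^S`. [cite: SerreGaloisCohomology1997, Ch. I §2.6(b)] -/
theorem rho_sub_self_mem_of_forall_mem (S : Subgroup G) (g₀ : G) (hnorm : ∀ s ∈ S, g₀⁻¹ * s * g₀ ∈ S)
    {v : X} (hv : ∀ s ∈ S, X.ρ s v = v) {s : G} (hs : s ∈ S) :
    X.ρ s (X.ρ g₀ v - v) = X.ρ g₀ v - v := by
  have h1 : s * g₀ = g₀ * (g₀⁻¹ * s * g₀) := by simp [mul_assoc]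
  rw [map_sub, hv s hs]
  congr 1
  change (X.ρ s * X.ρ g₀) v = X.ρ g₀ v
  rw [← map_mul, h1, map_mul]
  change X.ρ g₀ (X.ρ (g₀⁻¹ * s * g₀) v) = X.ρ g₀ v
  rw [hv _ (hnorm s hs)]

/-! ## §3 The count: classes principal on `S` number at most `#H⁰(G, X)` -/

/-- The principal crossed homomorphism `g ↦ g • v − v` exists as a CONTINUOUS cocycle when the orbit map of `v` is
continuous, and its class is zero. [cite: SerreGaloisCohomology1997, Ch. I §2.2 and §5.1] -/
theorem exists_contOneCocycles_principal (v : X) (hX : Continuous fun g : G ↦ X.ρ g v) :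
    ∃ β : contOneCocycles X, (∀ g, β.1 g = X.ρ g v - v) ∧ oneCocycleClass X β = 0 := by
  let β : contOneCocycles X :=
    ⟨⟨fun g ↦ X.ρ g v - v, hX.sub continuous_const⟩, fun g h ↦ by
      change X.ρ (g * h) v - v = (X.ρ g v - v) + X.ρ g (X.ρ h v - v)
      rw [map_sub, map_mul]
      change X.ρ g (X.ρ h v) - v = (X.ρ g v - v) + (X.ρ g (X.ρ h v) - X.ρ g v)
      abel⟩
  exact ⟨β, fun _ ↦ rfl, (oneCocycleClass_eq_zero_iff X β).2 ⟨v, fun _ ↦ rfl⟩⟩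

/-- **A class principal on `S` has a representative VANISHING on `S`** (subtract the principal cocycle).
[cite: SerreGaloisCohomology1997, Ch. I §2.6(b) (proof of inflation–restriction)] -/
theorem exists_oneCocycleClass_eq_and_forall_mem_eq_zero (hX : ∀ v : X, Continuous fun g : G ↦ X.ρ g v)
    (S : Subgroup G) {x : continuousCohomology 1 X}
    (hx : ∃ φ : contOneCocycles X, oneCocycleClass X φ = x ∧ ∃ v : X, ∀ s ∈ S, φ.1 s = X.ρ s v - v) :
    ∃ ψ : contOneCocycles X, oneCocycleClass X ψ = x ∧ ∀ s ∈ S, ψ.1 s = 0 := by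
  obtain ⟨φ, rfl, v, hv⟩ := hx
  obtain ⟨β, hβ, hβ0⟩ := exists_contOneCocycles_principal v (hX v)
  refine ⟨φ - β, ?_, fun s hs ↦ ?_⟩
  · rw [oneCocycleClass_sub, hβ0, sub_zero]
  · change φ.1 s - β.1 s = 0
    rw [hv s hs, hβ s, sub_self]

/-- For an endomorphism `f` of a FINITE abelian group, `#(A ⧸ f(A)) = #ker f`.
[cite: SerreGaloisCohomology1997, Local Fields Ch. XIII §1 (Herbrand quotient of a finite module is 1; folklore counting)] -/
theorem natCard_quotient_range_eq_natCard_ker_of_finite {A : Type v} [AddCommGroup A] [Finite A] (f : A →+ A) :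
    Nat.card (A ⧸ f.range) = Nat.card f.ker := by
  have h1 := AddSubgroup.card_eq_card_quotient_mul_card_addSubgroup f.ker
  have h2 := AddSubgroup.card_eq_card_quotient_mul_card_addSubgroup f.range
  have h3 : Nat.card (A ⧸ f.ker) = Nat.card f.range :=
    Nat.card_congr (QuotientAddGroup.quotientKerEquivRange f).toEquiv
  rw [h3] at h1
  have hpos : 0 < Nat.card f.range := Nat.card_pos
  rw [h1, mul_comm (Nat.card (A ⧸ f.range))] at h2
  exact (Nat.eq_of_mul_eq_mul_left hpos h2).symm

/-- **THE COUNT (with finiteness).** For `X` finite discrete with continuous orbit maps, `S ≤ G` normalised by `g₀` and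
`⟨S, g₀⟩` dense in `G`: the classes of `H¹(G, X)` admitting a representative that is PRINCIPAL ON `S` — the kernel of
the restriction to `S` — form a finite set with at most `#H⁰(G, X) = #{v | ∀ g, g • v = v}` elements.  (Embed, via a
representative `ψ` vanishing on `S`, by `x ↦ ψ(g₀) mod (g₀−1)X^S`: well defined and injective by §1–§2; and
`#(X^S ⧸ (g₀−1)X^S) = #ker(g₀−1 | X^S) = #X^G` by §1.)
[cite: SerreGaloisCohomology1997, Ch. I §2.6(b); Local Fields Ch. XIII §1 Prop. 1 (H¹ of a procyclic group)] [cite: NeukirchSchmidtWingberg2008, (1.6.7), (1.7.7)] -/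
theorem finite_and_natCard_setOf_oneCocycleClass_restrict_eq_zero_le [Finite X] [DiscreteTopology X]
    (hX : ∀ v : X, Continuous fun g : G ↦ X.ρ g v) (S : Subgroup G) (g₀ : G)
    (hnorm : ∀ s ∈ S, g₀⁻¹ * s * g₀ ∈ S) (hdense : Dense ((Subgroup.closure ((S : Set G) ∪ {g₀})) : Set G)) :
    Finite {x : continuousCohomology 1 X //
        ∃ φ : contOneCocycles X, oneCocycleClass X φ = x ∧ ∃ v : X, ∀ s ∈ S, φ.1 s = X.ρ s v - v} ∧
      Nat.card {x : continuousCohomology 1 X //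
          ∃ φ : contOneCocycles X, oneCocycleClass X φ = x ∧ ∃ v : X, ∀ s ∈ S, φ.1 s = X.ρ s v - v} ≤
        Nat.card {v : X // ∀ g : G, X.ρ g v = v} := by
  classical
  -- `X^S` and the endomorphism `g₀ − 1` of it
  let XS : AddSubgroup X :=
    { carrier := {v | ∀ s ∈ S, X.ρ s v = v}
      zero_mem' := fun s _ ↦ map_zero _
      add_mem' := fun {a b} ha hb s hs ↦ by rw [map_add, ha s hs, hb s hs]
      neg_mem' := fun {a} ha s hs ↦ by rw [map_neg, ha s hs] }
  have hXS : ∀ v : X, v ∈ XS ↔ ∀ s ∈ S, X.ρ s v = v := fun v ↦ Iff.rfl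
  let T : XS →+ XS :=
    { toFun := fun v ↦ ⟨X.ρ g₀ v.1 - v.1, fun s hs ↦
        rho_sub_self_mem_of_forall_mem S g₀ hnorm ((hXS v.1).1 v.2) hs⟩
      map_zero' := by
        apply Subtype.ext
        change X.ρ g₀ 0 - 0 = 0
        rw [map_zero, sub_zero]
      map_add' := fun a b ↦ by
        apply Subtype.ext
        change X.ρ g₀ (a.1 + b.1) - (a.1 + b.1) = (X.ρ g₀ a.1 - a.1) + (X.ρ g₀ b.1 - b.1)
        rw [map_add]
        abel }
  have hT : ∀ v : XS, ((T v : XS) : X) = X.ρ g₀ v.1 - v.1 := fun v ↦ rfl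
  -- `#ker (g₀ − 1 | X^S) = #X^G`
  have hker : Nat.card T.ker = Nat.card {v : X // ∀ g : G, X.ρ g v = v} := by
    refine Nat.card_congr
      { toFun := fun v ↦ ⟨v.1.1, fun g ↦ ?_⟩
        invFun := fun v ↦ ⟨⟨v.1, fun s _ ↦ v.2 s⟩, ?_⟩
        left_inv := fun v ↦ rfl
        right_inv := fun v ↦ rfl }
    · have h1 : X.ρ g₀ v.1.1 - v.1.1 = 0 := by
        rw [← hT]
        have h2 := v.2
        rw [AddMonoidHom.mem_ker] at h2
        rw [h2]
        rfl
      exact forall_apply_eq_self_of_forall_mem_of_apply_eq_self S g₀ hdense v.1.1 (hX _) ((hXS _).1 v.1.2)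
        (sub_eq_zero.1 h1) g
    · rw [AddMonoidHom.mem_ker]
      apply Subtype.ext
      rw [hT]
      change X.ρ g₀ v.1 - v.1 = 0
      rw [v.2 g₀, sub_self]
  -- representatives vanishing on `S`
  have hrep : ∀ x : {x : continuousCohomology 1 X //
      ∃ φ : contOneCocycles X, oneCocycleClass X φ = x ∧ ∃ v : X, ∀ s ∈ S, φ.1 s = X.ρ s v - v},
      ∃ ψ : contOneCocycles X, oneCocycleClass X ψ = x.1 ∧ ∀ s ∈ S, ψ.1 s = 0 :=
    fun x ↦ exists_oneCocycleClass_eq_and_forall_mem_eq_zero hX S x.2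
  choose ψ hψx hψS using hrep
  -- the embedding `x ↦ ψ_x(g₀) mod (g₀ − 1)X^S`
  let Ψ : {x : continuousCohomology 1 X //
      ∃ φ : contOneCocycles X, oneCocycleClass X φ = x ∧ ∃ v : X, ∀ s ∈ S, φ.1 s = X.ρ s v - v} →
      XS ⧸ T.range :=
    fun x ↦ QuotientAddGroup.mk ⟨(ψ x).1 g₀, (hXS _).2 fun s hs ↦
      contOneCocycles.apply_eq_self_of_forall_mem_eq_zero (ψ x) S g₀ hnorm (hψS x) hs⟩
  have hΨ : ∀ x, Ψ x = QuotientAddGroup.mk ⟨(ψ x).1 g₀, (hXS _).2 fun s hs ↦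
      contOneCocycles.apply_eq_self_of_forall_mem_eq_zero (ψ x) S g₀ hnorm (hψS x) hs⟩ := fun _ ↦ rfl
  have hinj : Function.Injective Ψ := by
    intro x y hxy
    rw [hΨ, hΨ, QuotientAddGroup.eq] at hxy
    obtain ⟨w, hw⟩ := hxy
    -- `g₀ w − w = −ψ_x(g₀) + ψ_y(g₀)` with `w ∈ X^S`
    have hw' : X.ρ g₀ w.1 - w.1 = -(ψ x).1 g₀ + (ψ y).1 g₀ := by
      rw [← hT]
      exact congrArg (fun z : XS ↦ (z : X)) hw
    -- the crossed homomorphism `ψ_y − ψ_x − ∂w` vanishes on `S` and at `g₀`, hence is zero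
    obtain ⟨β, hβ, hβ0⟩ := exists_contOneCocycles_principal w.1 (hX w.1)
    have h3 : (ψ y - ψ x) - β = 0 := by
      refine contOneCocycles.eq_zero_of_forall_mem_eq_zero_of_apply_eq_zero S g₀ hdense _
        (fun s hs ↦ ?_) ?_
      · change ((ψ y).1 s - (ψ x).1 s) - β.1 s = 0
        rw [hψS y s hs, hψS x s hs, hβ s, (hXS _).1 w.2 s hs, sub_self, sub_self, sub_self]
      · change ((ψ y).1 g₀ - (ψ x).1 g₀) - β.1 g₀ = 0
        rw [hβ g₀, hw']
        abel
    have h4 : oneCocycleClass X (ψ y) - oneCocycleClass X (ψ x) = 0 := by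
      rw [← oneCocycleClass_sub, sub_eq_zero.1 h3, hβ0]
    apply Subtype.ext
    rw [← hψx x, ← hψx y]
    exact (sub_eq_zero.1 h4).symm
  -- count
  refine ⟨Finite.of_injective Ψ hinj, ?_⟩
  calc Nat.card {x : continuousCohomology 1 X //
          ∃ φ : contOneCocycles X, oneCocycleClass X φ = x ∧ ∃ v : X, ∀ s ∈ S, φ.1 s = X.ρ s v - v}
        ≤ Nat.card (XS ⧸ T.range) := Nat.card_le_card_of_injective Ψ hinj
    _ = Nat.card T.ker := natCard_quotient_range_eq_natCard_ker_of_finite T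
    _ = Nat.card {v : X // ∀ g : G, X.ρ g v = v} := hker

/-- The classes principal on `S` form a FINITE set (`X` finite).
[cite: SerreGaloisCohomology1997, Ch. I §2.6(b)] -/
theorem finite_setOf_oneCocycleClass_restrict_eq_zero [Finite X] [DiscreteTopology X]
    (hX : ∀ v : X, Continuous fun g : G ↦ X.ρ g v) (S : Subgroup G) (g₀ : G)
    (hnorm : ∀ s ∈ S, g₀⁻¹ * s * g₀ ∈ S) (hdense : Dense ((Subgroup.closure ((S : Set G) ∪ {g₀})) : Set G)) :
    Finite {x : continuousCohomology 1 X //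
        ∃ φ : contOneCocycles X, oneCocycleClass X φ = x ∧ ∃ v : X, ∀ s ∈ S, φ.1 s = X.ρ s v - v} :=
  (finite_and_natCard_setOf_oneCocycleClass_restrict_eq_zero_le hX S g₀ hnorm hdense).1

/-- **THE COUNT.** `#{x ∈ H¹(G, X) | x is principal on S} ≤ #H⁰(G, X)` (`X` finite discrete with continuous orbit
maps, `S` normalised by `g₀`, `⟨S, g₀⟩` dense).
[cite: SerreGaloisCohomology1997, Ch. I §2.6(b) and Local Fields Ch. XIII §1 Prop. 1] [cite: NeukirchSchmidtWingberg2008, (1.6.7), (1.7.7)] -/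
theorem natCard_setOf_oneCocycleClass_restrict_eq_zero_le [Finite X] [DiscreteTopology X]
    (hX : ∀ v : X, Continuous fun g : G ↦ X.ρ g v) (S : Subgroup G) (g₀ : G)
    (hnorm : ∀ s ∈ S, g₀⁻¹ * s * g₀ ∈ S) (hdense : Dense ((Subgroup.closure ((S : Set G) ∪ {g₀})) : Set G)) :
    Nat.card {x : continuousCohomology 1 X //
        ∃ φ : contOneCocycles X, oneCocycleClass X φ = x ∧ ∃ v : X, ∀ s ∈ S, φ.1 s = X.ρ s v - v} ≤
      Nat.card {v : X // ∀ g : G, X.ρ g v = v} :=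
  (finite_and_natCard_setOf_oneCocycleClass_restrict_eq_zero_le hX S g₀ hnorm hdense).2

/-! ## §4 The pullback form: the kernel of `H¹(G, X) → H¹(H, Y)` along `θ : H → G` onto `S` -/

variable {H : Type v} [Group H] [TopologicalSpace H] [IsTopologicalGroup H] {Y : TopRep.{v} R H}

/-- A class killed by the restriction `ContinuousCohomology.map θ f 1` along a continuous `θ : H → G` mapping ONTO
`S`, with `f : res θ X ⟶ Y` bijective (e.g. the identity of the restricted module), is principal on `S`.
[cite: SerreGaloisCohomology1997, Ch. I §2.4 (compatible pairs) and §2.6(b)] -/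
theorem exists_principal_of_map_oneCocycleClass_eq_zero (θ : H →ₜ* G) (f : res (θ : H →* G) X ⟶ Y)
    (hf : Function.Bijective f.hom) (S : Subgroup G) (hSθ : ∀ s ∈ S, ∃ h, θ h = s)
    {x : continuousCohomology 1 X} (hx : ContinuousCohomology.map θ f 1 x = 0) :
    ∃ φ : contOneCocycles X, oneCocycleClass X φ = x ∧ ∃ v : X, ∀ s ∈ S, φ.1 s = X.ρ s v - v := by
  obtain ⟨φ, rfl⟩ := oneCocycleClass_surjective X x
  refine ⟨φ, rfl, ?_⟩
  rw [map_oneCocycleClass, oneCocycleClass_eq_zero_iff] at hx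
  obtain ⟨w, hw⟩ := hx
  obtain ⟨m, rfl⟩ := hf.2 w
  refine ⟨m, fun s hs ↦ ?_⟩
  obtain ⟨h, rfl⟩ := hSθ s hs
  apply hf.1
  rw [← contOneCocycles.pullback_apply X θ f φ h, hw h, map_sub, ← TopRep.hom_comm_apply f h m]
  rfl

/-- **The kernel of the restriction `H¹(G, X) → H¹(H, Y)` along `θ : H → G` ONTO a subgroup `S` normalised by `g₀`
with `⟨S, g₀⟩` dense has at most `#H⁰(G, X)` elements** (`X` finite discrete with continuous orbit maps, `f`
bijective). For `G = Γ_{K_v} ⊇ S = Gal(K̄_v/K_{∞,w})` (`K_∞/K` a `ℤ_p`-extension, `g₀ ∈ Γ_{K_v}` lifting a generator of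
the decomposition group in `Γ = Gal(K_∞/K)`) this reads `#ker(H¹(K_v, M) → H¹(K_{∞,w}, M)) ≤ #H⁰(K_v, M)`.
[cite: SerreGaloisCohomology1997, Ch. I §2.6(b); Local Fields Ch. XIII §1 Prop. 1] [cite: GreenbergLNM1716, §3 (local kernels along a ℤ_p-tower)] -/
theorem natCard_setOf_map_oneCocycleClass_eq_zero_le [Finite X] [DiscreteTopology X]
    (hX : ∀ v : X, Continuous fun g : G ↦ X.ρ g v) (S : Subgroup G) (g₀ : G)
    (hnorm : ∀ s ∈ S, g₀⁻¹ * s * g₀ ∈ S) (hdense : Dense ((Subgroup.closure ((S : Set G) ∪ {g₀})) : Set G))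
    (θ : H →ₜ* G) (f : res (θ : H →* G) X ⟶ Y) (hf : Function.Bijective f.hom) (hSθ : ∀ s ∈ S, ∃ h, θ h = s) :
    Finite {x : continuousCohomology 1 X // ContinuousCohomology.map θ f 1 x = 0} ∧
      Nat.card {x : continuousCohomology 1 X // ContinuousCohomology.map θ f 1 x = 0} ≤
        Nat.card {v : X // ∀ g : G, X.ρ g v = v} := by
  haveI := finite_setOf_oneCocycleClass_restrict_eq_zero hX S g₀ hnorm hdense
  let ι : {x : continuousCohomology 1 X // ContinuousCohomology.map θ f 1 x = 0} →
      {x : continuousCohomology 1 X //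
        ∃ φ : contOneCocycles X, oneCocycleClass X φ = x ∧ ∃ v : X, ∀ s ∈ S, φ.1 s = X.ρ s v - v} :=
    fun x ↦ ⟨x.1, exists_principal_of_map_oneCocycleClass_eq_zero θ f hf S hSθ x.2⟩
  have hι : Function.Injective ι :=
    fun x y hxy ↦ Subtype.ext (by have h := congrArg Subtype.val hxy; exact h)
  refine ⟨Finite.of_injective ι hι, ?_⟩
  calc Nat.card {x : continuousCohomology 1 X // ContinuousCohomology.map θ f 1 x = 0}
      ≤ Nat.card {x : continuousCohomology 1 X //
          ∃ φ : contOneCocycles X, oneCocycleClass X φ = x ∧ ∃ v : X, ∀ s ∈ S, φ.1 s = X.ρ s v - v} :=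
        Nat.card_le_card_of_injective ι hι
    _ ≤ Nat.card {v : X // ∀ g : G, X.ρ g v = v} :=
        natCard_setOf_oneCocycleClass_restrict_eq_zero_le hX S g₀ hnorm hdense

/-! ## §5 The density hypothesis for kernels of homomorphisms to `ℤ_p` on compact groups -/

section Density

variable {p : ℕ} [Fact p.Prime] {D : Type v} [Group D] [TopologicalSpace D] [IsTopologicalGroup D] [CompactSpace D]

/-- A CLOSED additive subgroup of `ℤ_p` containing `x` contains `x ℤ_p` (`ℕ` is dense in `ℤ_p`).
[cite: SerreGaloisCohomology1997, Ch. I §1.4 (closed subgroups of ℤ_p)] -/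
theorem PadicInt.mul_mem_of_isClosed_addSubgroup (A : AddSubgroup ℤ_[p]) (hA : IsClosed (A : Set ℤ_[p]))
    {x : ℤ_[p]} (hx : x ∈ A) (y : ℤ_[p]) : y * x ∈ A := by
  have hcont : Continuous fun z : ℤ_[p] ↦ z * x := continuous_id.mul continuous_const
  have hclosed : IsClosed ((fun z : ℤ_[p] ↦ z * x) ⁻¹' (A : Set ℤ_[p])) := hA.preimage hcont
  have hsub : Set.range (Nat.cast : ℕ → ℤ_[p]) ⊆ (fun z : ℤ_[p] ↦ z * x) ⁻¹' (A : Set ℤ_[p]) := by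
    rintro _ ⟨n, rfl⟩
    change (n : ℤ_[p]) * x ∈ A
    rw [← nsmul_eq_mul]
    exact A.nsmul_mem hx n
  have hall : (fun z : ℤ_[p] ↦ z * x) ⁻¹' (A : Set ℤ_[p]) = Set.univ := by
    rw [← hclosed.closure_eq]
    exact (PadicInt.denseRange_natCast.mono hsub).closure_eq
  have hy : y ∈ (fun z : ℤ_[p] ↦ z * x) ⁻¹' (A : Set ℤ_[p]) := by rw [hall]; exact Set.mem_univ y
  exact hy

/-- **For a continuous `κ : D →ₜ* ℤ_p` on a COMPACT group there is `g₀ ∈ D` with `⟨ker κ, g₀⟩` DENSE in `D`** (and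
`ker κ` is normal, normalised by `g₀`): the image of `κ` is `0` or `p^e ℤ_p` with `κ(g₀) = p^e`; the topological closure
`C` of `⟨ker κ, g₀⟩` is compact, so `κ(C)` is a closed subgroup containing `p^e`, i.e. all of `p^e ℤ_p = κ(D)`, and
`C ⊇ ker κ` forces `C = D`.  For `D = Γ_{K_v}` and `κ` a `ℤ_p`-extension of a number field `K` restricted along
`Γ_{K_v} → Γ_K`, `ker κ = Gal(K̄_v/K_{∞,w})`.
[cite: SerreGaloisCohomology1997, Ch. I §1.4] [cite: NeukirchSchmidtWingberg2008, (1.7.7) (procyclic groups)] -/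
theorem exists_dense_closure_ker_union_singleton (κ : D →ₜ* Multiplicative ℤ_[p]) :
    ∃ g₀ : D, (∀ s ∈ κ.toMonoidHom.ker, g₀⁻¹ * s * g₀ ∈ κ.toMonoidHom.ker) ∧
      Dense ((Subgroup.closure ((κ.toMonoidHom.ker : Set D) ∪ {g₀})) : Set D) := by
  have hnorm : ∀ g₀ : D, ∀ s ∈ κ.toMonoidHom.ker, g₀⁻¹ * s * g₀ ∈ κ.toMonoidHom.ker := by
    intro g₀ s hs
    rw [MonoidHom.mem_ker] at hs ⊢
    rw [map_mul, map_mul, hs, mul_one, map_inv, inv_mul_cancel]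
  rcases Literature.GroupTheory.kappa_eq_one_or_exists_image_eq_span_pow κ with htriv | ⟨e, hsub, hsurj⟩
  · refine ⟨1, hnorm 1, ?_⟩
    have hall : ((Subgroup.closure ((κ.toMonoidHom.ker : Set D) ∪ {1})) : Set D) = Set.univ := by
      refine Set.eq_univ_of_forall fun d ↦ Subgroup.subset_closure (Or.inl ?_)
      change d ∈ κ.toMonoidHom.ker
      rw [MonoidHom.mem_ker]
      exact htriv d
    rw [hall]
    exact dense_univ
  · obtain ⟨g₀, hg₀⟩ := hsurj ((p : ℤ_[p]) ^ e) (Ideal.mem_span_singleton_self _)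
    refine ⟨g₀, hnorm g₀, ?_⟩
    set L : Subgroup D := Subgroup.closure ((κ.toMonoidHom.ker : Set D) ∪ {g₀}) with hL
    -- the topological closure `C` of `L` and the additive image `A = κ(C)`
    let C : Subgroup D := L.topologicalClosure
    have hCclosed : IsClosed (C : Set D) := Subgroup.isClosed_topologicalClosure L
    have hLC : L ≤ C := Subgroup.le_topologicalClosure L
    have hkerC : ∀ s ∈ κ.toMonoidHom.ker, s ∈ C := fun s hs ↦ hLC (Subgroup.subset_closure (Or.inl hs))
    have hg₀C : g₀ ∈ C := hLC (Subgroup.subset_closure (Or.inr rfl))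
    let A : AddSubgroup ℤ_[p] :=
      { carrier := (fun d : D ↦ Multiplicative.toAdd (κ d)) '' (C : Set D)
        zero_mem' := ⟨1, C.one_mem, by simp⟩
        add_mem' := by
          rintro _ _ ⟨a, ha, rfl⟩ ⟨b, hb, rfl⟩
          exact ⟨a * b, C.mul_mem ha hb, by simp [map_mul, toAdd_mul]⟩
        neg_mem' := by
          rintro _ ⟨a, ha, rfl⟩
          exact ⟨a⁻¹, C.inv_mem ha, by simp [map_inv, toAdd_inv]⟩ }
    have hAclosed : IsClosed (A : Set ℤ_[p]) := by
      have hcont : Continuous fun d : D ↦ Multiplicative.toAdd (κ d) :=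
        continuous_toAdd.comp κ.continuous
      exact ((hCclosed.isCompact).image hcont).isClosed
    have hpeA : (p : ℤ_[p]) ^ e ∈ A := ⟨g₀, hg₀C, hg₀⟩
    -- every `d ∈ D` lies in `C`
    have hall : ∀ d : D, d ∈ C := by
      intro d
      obtain ⟨a, ha⟩ := Ideal.mem_span_singleton'.1 (hsub d)
      have hmem : Multiplicative.toAdd (κ d) ∈ A := by
        rw [← ha]
        exact PadicInt.mul_mem_of_isClosed_addSubgroup A hAclosed hpeA a
      obtain ⟨c, hc, hcd⟩ := hmem
      have hcd' : κ c = κ d := Multiplicative.toAdd.injective hcd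
      have hker : c⁻¹ * d ∈ κ.toMonoidHom.ker := by
        rw [MonoidHom.mem_ker, map_mul, map_inv]
        change (κ c)⁻¹ * κ d = 1
        rw [hcd', inv_mul_cancel]
      have hmul : c * (c⁻¹ * d) ∈ C := C.mul_mem hc (hkerC _ hker)
      rwa [mul_inv_cancel_left] at hmul
    have hCtop : (C : Set D) = Set.univ := Set.eq_univ_of_forall hall
    rw [dense_iff_closure_eq, ← Subgroup.topologicalClosure_coe]
    exact hCtop

end Density

/-! ## §6 The matching `H⁰` bound for a cyclic line with one scalar element -/

section Line

variable {S : Type u} [CommRing S] {M : Type v} [AddCommGroup M] [Module S M] [Finite M]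

/-- **`#{x | μ•x = x} ≤ #(S ⧸ (μ − 1))` for a finite CYCLIC `S`-module `M = S·x₀`**: on a finite group the kernel and the
cokernel of `μ − 1` have the same order, and `a ↦ a•x₀` maps `S ⧸ (μ − 1)` onto `M ⧸ (μ − 1)M`.
[cite: Howard2004HeegnerKolyvagin, Lemma 3.2.7 and proof of Thm. 2.2.10 (counting on cyclic S_𝔮-lines)] [cite: SerreGaloisCohomology1997, Local Fields Ch. XIII §1 (Herbrand quotient of a finite module)] -/
theorem natCard_fixedBy_smul_le_natCard_quotient_span (x₀ : M) (hcyc : ∀ x : M, ∃ a : S, a • x₀ = x) (μ : S)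
    [Finite (S ⧸ Ideal.span {μ - 1})] :
    Nat.card {x : M // μ • x = x} ≤ Nat.card (S ⧸ Ideal.span {μ - 1}) := by
  classical
  -- the endomorphism `μ − 1`
  let f : M →+ M := DistribSMul.toAddMonoidHom M (μ - 1)
  have hf : ∀ x, f x = (μ - 1) • x := fun _ ↦ rfl
  -- `#ker f = #{x | μ x = x}`
  have hker : Nat.card {x : M // μ • x = x} = Nat.card f.ker := by
    refine Nat.card_congr (Equiv.subtypeEquivRight fun x ↦ ?_)
    rw [AddMonoidHom.mem_ker, hf, sub_smul, one_smul, sub_eq_zero]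
  rw [hker, ← natCard_quotient_range_eq_natCard_ker_of_finite f]
  -- `S ⧸ (μ − 1) ↠ M ⧸ f(M)` via `a ↦ a • x₀`
  let e : S →+ M ⧸ f.range := (QuotientAddGroup.mk' f.range).comp ((smulAddHom S M).flip x₀)
  have he : ∀ a : S, e a = QuotientAddGroup.mk (a • x₀) := fun _ ↦ rfl
  have hesurj : Function.Surjective e := by
    intro q
    obtain ⟨x, rfl⟩ := QuotientAddGroup.mk_surjective q
    obtain ⟨a, rfl⟩ := hcyc x
    exact ⟨a, he a⟩
  -- it kills `(μ − 1)`
  have hvanish : ∀ a ∈ Ideal.span {μ - 1}, e a = 0 := by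
    intro a ha
    obtain ⟨b, rfl⟩ := Ideal.mem_span_singleton'.1 ha
    rw [he, QuotientAddGroup.eq_zero_iff]
    refine ⟨b • x₀, ?_⟩
    rw [hf, ← mul_smul, mul_comm]
  -- descend to the quotient and count
  let ebar : S ⧸ Ideal.span {μ - 1} →+ M ⧸ f.range :=
    QuotientAddGroup.lift (Ideal.span {μ - 1}).toAddSubgroup e (fun a ha ↦ hvanish a ha)
  have hebar : Function.Surjective ebar := by
    intro q
    obtain ⟨a, rfl⟩ := hesurj q
    exact ⟨Ideal.Quotient.mk _ a, rfl⟩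
  exact Nat.card_le_card_of_surjective ebar hebar

/-- **`#H⁰(G, X) ≤ #(S ⧸ (μ − 1))` when ONE element `g₁` acts on the cyclic line `X = S·x₀` as the scalar `μ`** (any action
`τ` of any `G` by additive maps; the invariants of all of `G` lie among the fixed points of `g₁`).  For Howard's graded line
`gr_v T^{(j)} = A_{m,j} ⊗ gr_v E[p^j]` at `v ∣ p` and `g₁ ∈ Γ_{K_v}` with `κ(g₁) = p^s` this gives `#H⁰(K_v, gr_v T^{(j)}) ≤ p^{p^s}`
(`μ − 1 = λ(1+T)^{p^s} − 1`, unit coefficient in degree `p^s < m`), uniformly in `j` and `m`.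
[cite: Howard2004HeegnerKolyvagin, Lemma 3.2.7, §3.1 (gr_v) and proof of Thm. 2.2.10] -/
theorem natCard_setOf_forall_apply_eq_self_le_of_apply_eq_smul {G : Type*} (τ : G → M →+ M) (x₀ : M)
    (hcyc : ∀ x : M, ∃ a : S, a • x₀ = x) (g₁ : G) (μ : S) (hμ : ∀ x : M, τ g₁ x = μ • x)
    [Finite (S ⧸ Ideal.span {μ - 1})] :
    Nat.card {x : M // ∀ g : G, τ g x = x} ≤ Nat.card (S ⧸ Ideal.span {μ - 1}) := by
  calc Nat.card {x : M // ∀ g : G, τ g x = x} ≤ Nat.card {x : M // μ • x = x} :=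
        Nat.card_le_card_of_injective (fun x ↦ ⟨x.1, by rw [← hμ]; exact x.2 g₁⟩)
          (fun x y hxy ↦ Subtype.ext (by have h := congrArg Subtype.val hxy; exact h))
    _ ≤ Nat.card (S ⧸ Ideal.span {μ - 1}) := natCard_fixedBy_smul_le_natCard_quotient_span x₀ hcyc μ

/-- **Quotient form: `#{q ∈ M ⧸ N | ḡ q = q} ≤ #(S ⧸ (μ − 1))`** for a finite `S`-module `M`, an `S`-stable subgroup `N` with
`M = S·x₀ + N` (the quotient is a CYCLIC LINE), and an additive map `g` of `M` acting as the scalar `μ` MODULO `N`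
(`g x − μ•x ∈ N`), `ḡ` the induced map of `M ⧸ N` (`ḡ (mk x) = mk (g x)`).  (The fixed points of `ḡ` are the kernel of the
endomorphism `mk ∘ (μ − 1)` of `M ⧸ N`; count its cokernel through `a ↦ a•x₀`.)  For Howard's graded line
`gr_v T^{(j)} = (A_{m,j} ⊗ E[p^j]) ⧸ (A_{m,j} ⊗ Fil_v E[p^j])` and `g = σ₀ ∈ Γ_{K_v}` acting on `gr_v E[p^j]` by the integer `n₀`:
`μ = n₀ (1+T)^{κ(σ₀)}`.
[cite: Howard2004HeegnerKolyvagin, Lemma 3.2.7, §3.1 (gr_v) and proof of Thm. 2.2.10] [cite: GreenbergLNM1716, §2 (anomalous primes: H⁰(K_v, gr))] -/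
theorem natCard_setOf_quotient_apply_eq_self_le (N : Submodule ℤ M) (hN : ∀ (a : S) (x : M), x ∈ N → a • x ∈ N) (x₀ : M)
    (hcyc : ∀ x : M, ∃ a : S, x - a • x₀ ∈ N) (μ : S) (g : M → M) (hμ : ∀ x : M, g x - μ • x ∈ N)
    (gbar : M ⧸ N → M ⧸ N) (hg : ∀ x : M, gbar (Submodule.Quotient.mk x) = Submodule.Quotient.mk (g x))
    [Finite (S ⧸ Ideal.span {μ - 1})] :
    Nat.card {q : M ⧸ N // gbar q = q} ≤ Nat.card (S ⧸ Ideal.span {μ - 1}) := by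
  classical
  -- the endomorphism `ψ = mk ∘ (μ − 1)` of `M ⧸ N`
  let φ : M →ₗ[ℤ] M ⧸ N := N.mkQ ∘ₗ (DistribSMul.toAddMonoidHom M (μ - 1)).toIntLinearMap
  have hφ : ∀ x : M, φ x = Submodule.Quotient.mk ((μ - 1) • x) := fun _ ↦ rfl
  have hNφ : N ≤ LinearMap.ker φ := by
    intro x hx
    rw [LinearMap.mem_ker, hφ, Submodule.Quotient.mk_eq_zero]
    exact hN _ _ hx
  let ψ : M ⧸ N →+ M ⧸ N := (N.liftQ φ hNφ).toAddMonoidHom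
  have hψ : ∀ x : M, ψ (Submodule.Quotient.mk x) = Submodule.Quotient.mk ((μ - 1) • x) := fun _ ↦ rfl
  -- fixed points of `ḡ` = kernel of `ψ`
  have hfix : Nat.card {q : M ⧸ N // gbar q = q} = Nat.card ψ.ker := by
    refine Nat.card_congr (Equiv.subtypeEquivRight fun q ↦ ?_)
    induction q using Submodule.Quotient.induction_on with
    | _ x =>
      rw [AddMonoidHom.mem_ker, hψ, hg, Submodule.Quotient.eq, Submodule.Quotient.mk_eq_zero]
      have heq : (μ - 1) • x = (g x - x) - (g x - μ • x) := by rw [sub_smul, one_smul]; abel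
      rw [heq]
      constructor
      · intro h; exact N.sub_mem h (hμ x)
      · intro h
        have h2 := N.add_mem h (hμ x)
        rwa [sub_add_cancel] at h2
  haveI : Finite (M ⧸ N) := Finite.of_surjective _ (Submodule.Quotient.mk_surjective N)
  rw [hfix, ← natCard_quotient_range_eq_natCard_ker_of_finite ψ]
  -- `S ↠ (M ⧸ N) ⧸ ψ(M ⧸ N)` via `a ↦ [[a • x₀]]`, killing `(μ − 1)`
  let e : S →+ (M ⧸ N) ⧸ ψ.range :=
    (QuotientAddGroup.mk' ψ.range).comp (N.mkQ.toAddMonoidHom.comp ((smulAddHom S M).flip x₀))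
  have he : ∀ a : S, e a = QuotientAddGroup.mk (Submodule.Quotient.mk (p := N) (a • x₀)) := fun _ ↦ rfl
  have hesurj : Function.Surjective e := by
    intro r
    obtain ⟨q, rfl⟩ := QuotientAddGroup.mk_surjective r
    obtain ⟨x, rfl⟩ := Submodule.Quotient.mk_surjective N q
    obtain ⟨a, ha⟩ := hcyc x
    refine ⟨a, ?_⟩
    rw [he]
    have hmk : Submodule.Quotient.mk (p := N) (a • x₀) = Submodule.Quotient.mk x := by
      rw [Submodule.Quotient.eq, ← neg_sub]
      exact N.neg_mem ha
    rw [hmk]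
  have hvanish : ∀ a ∈ Ideal.span {μ - 1}, e a = 0 := by
    intro a ha
    obtain ⟨b, rfl⟩ := Ideal.mem_span_singleton'.1 ha
    rw [he, QuotientAddGroup.eq_zero_iff]
    refine ⟨Submodule.Quotient.mk (b • x₀), ?_⟩
    rw [hψ, ← mul_smul, mul_comm]
  let ebar : S ⧸ Ideal.span {μ - 1} →+ (M ⧸ N) ⧸ ψ.range :=
    QuotientAddGroup.lift (Ideal.span {μ - 1}).toAddSubgroup e (fun a ha ↦ hvanish a ha)
  have hebar : Function.Surjective ebar := by
    intro r
    obtain ⟨a, rfl⟩ := hesurj r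
    exact ⟨Ideal.Quotient.mk _ a, rfl⟩
  exact Nat.card_le_card_of_surjective ebar hebar

end Line

end Literature.NumberTheory.GaloisRepresentations
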